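import Mathlib
import HarnessLib

/-!
# Tilted means of bounded observables: the derivative of a tilted mean is the tilted covariance

Free-hands helper (pure probability, `G`-free) for the crux ⟨stmt-QuantumFields-24006⟩ `AllWindowsColdBox.BulkMidWindowSU2`
(LINE-18 v5, stubs S6/S7), part 1/2 of the content of piece **P3 `TiltResponseCalculus`** of the crux idea
«fluctuation-response» (`Cruxes/BulkMidWindowSU2/FluctuationResponseSketch.lean`, crux-ideate seat 1, 2026-08-30).

For a probability measure `μ`, bounded measurable `W, Y` and the tilted family `μ_σ = μ.tilted (σ·Y)`:
* `integral_tilted_eq_div` — the tilted mean as a quotient `E_{ν.tilted f}[W] = ∫ W e^f / ∫ e^f`;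
* `tilted_add_const`, `tilted_mul_tilted` — constants cancel; the translation identity `(μ_σ).tilted(τ(Y − c)) = μ_{σ+τ}`;
* `hasDerivAt_integral_mul_exp` — dominated differentiation of `t ↦ ∫ W e^{tV} dν`;
* `hasDerivAt_tiltedMean_zero` / `hasDerivAt_tiltedMean` — `σ ↦ E_{μ_σ}[W]` has derivative
  `Cov_{μ_σ}(W, Y) = E_σ[WY] − E_σ[W]E_σ[Y]` at every `σ`.
Part 2 (`…TiltResponseCalculus`) iterates this to the fourth joint cumulant and fences the symmetric difference quotient.

HONEST LABEL: elementary probability; a would-be piece of an UN-TRIAGED crux idea, landed as a helper (`--supports 24006`);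
no stub of LINE-18, no crux, rung or summit is proved; the Yang–Mills mass gap is NOT proved. [folklore]
-/

noncomputable section

open MeasureTheory Real Set Filter Topology

namespace Summit.QuantumFields.YangMills.Theorems.TiltedCumulant

variable {Ω : Type*} [MeasurableSpace Ω]

/-! ## §1 Bounded measurable observables: integrability, the tilted family, the tilted mean as a quotient -/

/-- A bounded measurable real function is integrable against a finite measure. -/
theorem integrable_of_abs_le (ν : Measure Ω) [IsFiniteMeasure ν] {W : Ω → ℝ} (hW : Measurable W) {C : ℝ}
    (hC : ∀ z, |W z| ≤ C) : Integrable W ν :=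
  (integrable_const C).mono' hW.aestronglyMeasurable (ae_of_all _ fun z => by
    rw [Real.norm_eq_abs]; exact hC z)

/-- `exp (t·Y)` is integrable for bounded measurable `Y` (finite measure). -/
theorem integrable_exp_mul (ν : Measure Ω) [IsFiniteMeasure ν] {Y : Ω → ℝ} (hY : Measurable Y) {B : ℝ}
    (hB : ∀ z, |Y z| ≤ B) (t : ℝ) : Integrable (fun z => exp (t * Y z)) ν := by
  refine integrable_of_abs_le ν (measurable_exp.comp (measurable_const.mul hY)) (C := exp (|t| * B)) fun z => ?_
  rw [abs_of_pos (exp_pos _), exp_le_exp]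
  calc t * Y z ≤ |t * Y z| := le_abs_self _
    _ = |t| * |Y z| := abs_mul _ _
    _ ≤ |t| * B := mul_le_mul_of_nonneg_left (hB z) (abs_nonneg _)

/-- The tilted measure `ν.tilted (t·Y)` of a probability measure by a bounded `Y` is a probability measure. -/
theorem isProbabilityMeasure_tilted_mul (ν : Measure Ω) [IsProbabilityMeasure ν] {Y : Ω → ℝ} (hY : Measurable Y)
    {B : ℝ} (hB : ∀ z, |Y z| ≤ B) (t : ℝ) : IsProbabilityMeasure (ν.tilted fun z => t * Y z) :=
  isProbabilityMeasure_tilted (integrable_exp_mul ν hY hB t)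

/-- The tilted mean as a quotient: `E_{ν.tilted f}[W] = (∫ W e^{f}) / (∫ e^{f})`. -/
theorem integral_tilted_eq_div (ν : Measure Ω) (f W : Ω → ℝ) :
    ∫ z, W z ∂(ν.tilted f) = (∫ z, W z * exp (f z) ∂ν) / ∫ z, exp (f z) ∂ν := by
  rw [integral_tilted]
  simp_rw [smul_eq_mul]
  rw [← integral_div]
  refine integral_congr_ae (ae_of_all _ fun z => ?_)
  simp only
  ring

/-- Tilting by `f + c` equals tilting by `f` (constants cancel in the normalisation). -/
theorem tilted_add_const (ν : Measure Ω) [IsProbabilityMeasure ν] {f : Ω → ℝ}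
    (hf : Integrable (fun z => exp (f z)) ν) (c : ℝ) :
    ν.tilted (fun z => f z + c) = ν.tilted f := by
  haveI : IsProbabilityMeasure (ν.tilted f) := isProbabilityMeasure_tilted hf
  have h := tilted_tilted hf (fun _ : Ω => c)
  rw [tilted_const] at h
  have e : (fun z => f z + c) = f + fun _ => c := by funext z; simp only [Pi.add_apply]
  rw [e]; exact h.symm

/-- **Translation identity**: `(μ.tilted (σY)).tilted (τ(Y − c)) = μ.tilted ((σ+τ)Y)` for bounded `Y` and any constant
`c` (used with `c = E_{μ_σ}Y`). -/
theorem tilted_mul_tilted (μ : Measure Ω) [IsProbabilityMeasure μ] {Y : Ω → ℝ} (hY : Measurable Y) {B : ℝ}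
    (hB : ∀ z, |Y z| ≤ B) (σ τ c : ℝ) :
    (μ.tilted fun z => σ * Y z).tilted (fun z => τ * (Y z - c)) = μ.tilted fun z => (σ + τ) * Y z := by
  rw [tilted_tilted (integrable_exp_mul μ hY hB σ)]
  have h1 : ((fun z => σ * Y z) + fun z => τ * (Y z - c)) = fun z => (σ + τ) * Y z + (-(τ * c)) := by
    funext z; simp only [Pi.add_apply]; ring
  rw [h1, tilted_add_const μ (integrable_exp_mul μ hY hB (σ + τ))]

/-! ## §2 Dominated differentiation of `t ↦ ∫ W e^{tV} dν` -/

/-- **Parametric derivative.**  For bounded measurable `W, V` on a finite measure space,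
`t ↦ ∫ W e^{tV} dν` has derivative `∫ W V e^{tV} dν` everywhere. -/
theorem hasDerivAt_integral_mul_exp (ν : Measure Ω) [IsFiniteMeasure ν] {W V : Ω → ℝ} (hW : Measurable W)
    (hV : Measurable V) {CW CV : ℝ} (hWb : ∀ z, |W z| ≤ CW) (hVb : ∀ z, |V z| ≤ CV) (t₀ : ℝ) :
    HasDerivAt (fun t => ∫ z, W z * exp (t * V z) ∂ν) (∫ z, W z * V z * exp (t₀ * V z) ∂ν) t₀ := by
  -- (we avoid needing `0 ≤ CW` by bounding with `|CW|`)
  set bound : Ω → ℝ := fun _ => |CW| * |CV| * exp ((|t₀| + 1) * |CV|) with hbound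
  have hmeasF : ∀ t, AEStronglyMeasurable (fun z => W z * exp (t * V z)) ν := fun t =>
    (hW.mul (measurable_exp.comp (measurable_const.mul hV))).aestronglyMeasurable
  have hmeasF' : ∀ t, AEStronglyMeasurable (fun z => W z * V z * exp (t * V z)) ν := fun t =>
    ((hW.mul hV).mul (measurable_exp.comp (measurable_const.mul hV))).aestronglyMeasurable
  have hint : Integrable (fun z => W z * exp (t₀ * V z)) ν := by
    refine integrable_of_abs_le ν (hW.mul (measurable_exp.comp (measurable_const.mul hV)))
      (C := |CW| * exp (|t₀| * |CV|)) fun z => ?_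
    rw [abs_mul, abs_of_pos (exp_pos _)]
    refine mul_le_mul ((hWb z).trans (le_abs_self _)) ?_ (exp_pos _).le (abs_nonneg _)
    rw [exp_le_exp]
    calc t₀ * V z ≤ |t₀ * V z| := le_abs_self _
      _ = |t₀| * |V z| := abs_mul _ _
      _ ≤ |t₀| * |CV| := mul_le_mul_of_nonneg_left ((hVb z).trans (le_abs_self _)) (abs_nonneg _)
  have h := hasDerivAt_integral_of_dominated_loc_of_deriv_le (μ := ν) (F := fun t z => W z * exp (t * V z))
    (F' := fun t z => W z * V z * exp (t * V z)) (x₀ := t₀) (s := Metric.ball t₀ 1) (bound := bound)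
    (Metric.ball_mem_nhds t₀ one_pos) (Eventually.of_forall hmeasF) hint (hmeasF' t₀) ?_ (integrable_const _) ?_
  · exact h.2
  · refine ae_of_all _ fun z t ht => ?_
    rw [Metric.mem_ball, Real.dist_eq] at ht
    have ht' : |t| ≤ |t₀| + 1 := by
      have := abs_sub_abs_le_abs_sub t t₀
      linarith
    rw [hbound, Real.norm_eq_abs, abs_mul, abs_mul, abs_of_pos (exp_pos _)]
    refine mul_le_mul (mul_le_mul ((hWb z).trans (le_abs_self _)) ((hVb z).trans (le_abs_self _))
      (abs_nonneg _) (abs_nonneg _)) ?_ (exp_pos _).le (mul_nonneg (abs_nonneg _) (abs_nonneg _))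
    rw [exp_le_exp]
    calc t * V z ≤ |t * V z| := le_abs_self _
      _ = |t| * |V z| := abs_mul _ _
      _ ≤ (|t₀| + 1) * |CV| :=
          mul_le_mul ht' ((hVb z).trans (le_abs_self _)) (abs_nonneg _) (by positivity)
  · refine ae_of_all _ fun z t _ => ?_
    have h1 : HasDerivAt (fun t : ℝ => t * V z) (V z) t := by
      simpa using (hasDerivAt_id t).mul_const (V z)
    have h2 : HasDerivAt (fun t : ℝ => exp (t * V z)) (exp (t * V z) * V z) t := (Real.hasDerivAt_exp _).comp t h1
    have h3 := h2.const_mul (W z)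
    simpa [mul_comm, mul_left_comm, mul_assoc] using h3

/-! ## §3 The derivative of a tilted mean is the tilted covariance -/

/-- **At the base point.**  For a probability measure `ν` and bounded measurable `W, V`:
`d/dt|₀ E_{ν.tilted(tV)}[W] = E_ν[WV] − E_ν[W]E_ν[V]`. -/
theorem hasDerivAt_tiltedMean_zero (ν : Measure Ω) [IsProbabilityMeasure ν] {W V : Ω → ℝ} (hW : Measurable W)
    (hV : Measurable V) {CW CV : ℝ} (hWb : ∀ z, |W z| ≤ CW) (hVb : ∀ z, |V z| ≤ CV) :
    HasDerivAt (fun t => ∫ z, W z ∂(ν.tilted fun z => t * V z))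
      ((∫ z, W z * V z ∂ν) - (∫ z, W z ∂ν) * (∫ z, V z ∂ν)) 0 := by
  -- numerator and denominator
  have hN := hasDerivAt_integral_mul_exp ν hW hV hWb hVb 0
  have hD := hasDerivAt_integral_mul_exp ν (W := fun _ => (1 : ℝ)) measurable_const hV (CW := 1)
    (fun _ => by simp) hVb 0
  have hD0 : (∫ z, (1 : ℝ) * exp (0 * V z) ∂ν) = 1 := by simp
  have hN0 : (∫ z, W z * exp (0 * V z) ∂ν) = ∫ z, W z ∂ν := by simp
  have hN1 : (∫ z, W z * V z * exp (0 * V z) ∂ν) = ∫ z, W z * V z ∂ν := by simp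
  have hD1 : (∫ z, (1 : ℝ) * V z * exp (0 * V z) ∂ν) = ∫ z, V z ∂ν := by simp
  have hquot := hN.div hD (by rw [hD0]; exact one_ne_zero)
  rw [hD0, hN0, hN1, hD1] at hquot
  have hfun : (fun t => ∫ z, W z ∂(ν.tilted fun z => t * V z)) =
      fun t => (∫ z, W z * exp (t * V z) ∂ν) / ∫ z, (1 : ℝ) * exp (t * V z) ∂ν := by
    funext t
    rw [integral_tilted_eq_div]
    simp only [one_mul]
  rw [hfun]
  have hquot' : HasDerivAt (fun t => (∫ z, W z * exp (t * V z) ∂ν) / ∫ z, (1 : ℝ) * exp (t * V z) ∂ν)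
      (((∫ z, W z * V z ∂ν) * 1 - (∫ z, W z ∂ν) * ∫ z, V z ∂ν) / 1 ^ 2) 0 := hquot
  refine hquot'.congr_deriv ?_
  ring

/-- **At every point.**  For a probability measure `μ`, bounded measurable `W, Y` and every `σ`:
`σ ↦ E_{μ.tilted(σY)}[W]` has derivative `Cov_{μ.tilted(σY)}(W, Y) = E_σ[WY] − E_σ[W]E_σ[Y]` at `σ`. -/
theorem hasDerivAt_tiltedMean (μ : Measure Ω) [IsProbabilityMeasure μ] {W Y : Ω → ℝ} (hW : Measurable W)
    (hY : Measurable Y) {CW B : ℝ} (hWb : ∀ z, |W z| ≤ CW) (hB : ∀ z, |Y z| ≤ B) (σ : ℝ) :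
    HasDerivAt (fun s => ∫ z, W z ∂(μ.tilted fun z => s * Y z))
      ((∫ z, W z * Y z ∂(μ.tilted fun z => σ * Y z)) -
        (∫ z, W z ∂(μ.tilted fun z => σ * Y z)) * (∫ z, Y z ∂(μ.tilted fun z => σ * Y z))) σ := by
  set ν := μ.tilted fun z => σ * Y z with hν
  haveI : IsProbabilityMeasure ν := isProbabilityMeasure_tilted_mul μ hY hB σ
  -- derivative at 0 of the re-based family `τ ↦ E_{ν.tilted(τ(Y − 0))}[W]`
  have h0 := hasDerivAt_tiltedMean_zero ν hW hY hWb hB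
  -- translate: `ν.tilted (τY) = μ.tilted ((σ+τ)Y)`
  have htr : ∀ τ, ν.tilted (fun z => τ * Y z) = μ.tilted fun z => (σ + τ) * Y z := by
    intro τ
    have := tilted_mul_tilted μ hY hB σ τ 0
    simpa only [sub_zero] using this
  have hfun : (fun t => ∫ z, W z ∂(ν.tilted fun z => t * Y z)) =
      (fun s => ∫ z, W z ∂(μ.tilted fun z => s * Y z)) ∘ (fun t => σ + t) := by
    funext t; simp only [Function.comp_apply, htr]
  rw [hfun] at h0
  -- chain rule with the translation `t ↦ σ + t` at `t = 0`
  have hsh : HasDerivAt (fun s : ℝ => s - σ) 1 σ := by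
    simpa using (hasDerivAt_id σ).sub_const σ
  have hcomp := HasDerivAt.scomp (𝕜 := ℝ) σ (h := fun s : ℝ => s - σ)
    (g₁ := (fun s => ∫ z, W z ∂(μ.tilted fun z => s * Y z)) ∘ (fun t => σ + t)) (by simpa using h0) hsh
  have hid : ((fun s => ∫ z, W z ∂(μ.tilted fun z => s * Y z)) ∘ (fun t => σ + t)) ∘ (fun s : ℝ => s - σ) =
      fun s => ∫ z, W z ∂(μ.tilted fun z => s * Y z) := by
    funext s; simp only [Function.comp_apply, add_sub_cancel]
  rw [hid, one_smul] at hcomp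
  exact hcomp

end Summit.QuantumFields.YangMills.Theorems.TiltedCumulant

end
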